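import Summits.QuantumFields.YangMills.Theorems.NPointIsotropy.Negative.ModelBlindFalse

/-!
# Negative results on `PencilRigidity.NPointIsotropy`, VII: the sixteen mirrors separate every THREE points,
but not every four — the junk threshold is exactly `n = 4`

Seventh file of the standing disprover's analysis of crux stmt-QuantumFields-11686 (refuter, cdisprove, cycle 2).
Pure linear algebra / combinatorics of the sixteen mirror normals of `W(B₄)` (up to sign: `e_μ` and
`e_μ ± e_ν`, `μ ≠ ν`) — the normals of the reflection-positivity frames available to a `W(B₄)`-symmetric family
(the crux's eight planar frames transported by the proper signed permutations).

* `three_points_frame_separated`: for every NON-COINCIDENT configuration of three points of `ℝ⁴` there is a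
  mirror normal `n` such that the three pairings `⟪xᵢ, n⟫` are pairwise distinct, i.e. after relabelling the
  configuration is strictly time-ordered in that frame. Proof: for each coordinate pair `{μ, ν}` the four normals
  `e_μ, e_ν, e_μ ± e_ν` are pairwise independent on the `(μ,ν)`-plane, so by pigeonhole one of the three difference
  vectors `x₁ − x₀, x₂ − x₀, x₂ − x₁` vanishes in BOTH coordinates (`pair_core`, 81 linear cases); six pairs cannot
  be covered by the zero sets of three non-zero vectors one of which is the difference of the other two
  (`sep_core`, 729 linear cases).
* `four_points_not_frame_separated`: the configuration `0, 10e₃, 10e₂, 10e₀` (the bump centres of file IV) is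
  non-coincident and in EVERY one of the sixteen frames two of its points have equal time (file I, (L1)).

CONSEQUENCES (the boundary of the junk mechanism of files I–V). (i) The exceptional set
`𝔈ₙ = {x | ∀ mirror normals n ∃ i ≠ j, ⟪xᵢ − xⱼ, n⟫ = 0}` equals the coincidence locus for `n ≤ 3` and is strictly
larger from `n = 4` on: distributions invisible to every typed OS clause in all sixteen frames exist exactly in
degrees `≥ 4`, so `𝔖₁, 𝔖₂, 𝔖₃` of a `W(B₄)`-symmetric family ARE read off `⁰𝒮` by the sixteen-frame
time-ordered data (each non-coincident 3-point configuration lies in the open frame-ordered set of some frame),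
while `𝔖₄` is not (`not_NPointIsotropyWithoutTieAt4`). (ii) For provers of the n-point step: the degree-3 case
of any sixteen-frame analytic-continuation argument has no exceptional configurations to worry about; the first
genuinely new input is needed at degree 4.
-/

noncomputable section

-- Mathlib's `SimplexCategory` instance `Fintype (Fin (x.len + 1))` matches `Fintype (Fin 4)` (tree-known workaround,
-- files I–VI).
attribute [-instance] SimplexCategory.instFintypeToTypeOrderHomFinHAddNatLenOfNat

namespace Summit.QuantumFields.YangMills.Theorems.NPointIsotropy.Negative

open scoped InnerProductSpace
open Literature.MathematicalPhysics.AQFT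

/-- **The sixteen mirror normals of `W(B₄)` up to sign**: the axis normals `e_μ` and the diagonal normals
`e_μ + e_ν`, `e_μ − e_ν` (`μ ≠ ν`). -/
def IsMirrorNormal (n : E4) : Prop :=
  ∃ μ : Fin 4, n = EuclideanSpace.single μ 1 ∨
    ∃ ν : Fin 4, μ ≠ ν ∧ (n = EuclideanSpace.single μ 1 + EuclideanSpace.single ν 1 ∨
      n = EuclideanSpace.single μ 1 - EuclideanSpace.single ν 1)

/-! ## §1 The two linear-algebra cores -/

/-- **Plane pigeonhole** (81 linear cases): if each of the four pairwise independent directions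
`(1,0), (0,1), (1,1), (1,-1)` of a coordinate plane is orthogonal to one of the three plane vectors
`(a_μ,a_ν)`, `(b_μ,b_ν)`, `(a−b)_{μν}`, then one of the three vanishes. [folklore] -/
theorem pair_core (am an bm bn : ℝ) (h1 : am = 0 ∨ bm = 0 ∨ am = bm) (h2 : an = 0 ∨ bn = 0 ∨ an = bn)
    (h3 : am + an = 0 ∨ bm + bn = 0 ∨ am + an = bm + bn)
    (h4 : am - an = 0 ∨ bm - bn = 0 ∨ am - an = bm - bn) :
    (am = 0 ∧ an = 0) ∨ (bm = 0 ∧ bn = 0) ∨ (am = bm ∧ an = bn) := by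
  rcases h1 with h1 | h1 | h1 <;> rcases h2 with h2 | h2 | h2 <;> rcases h3 with h3 | h3 | h3 <;>
    rcases h4 with h4 | h4 | h4 <;>
    first
    | exact Or.inl ⟨by linarith, by linarith⟩
    | exact Or.inr (Or.inl ⟨by linarith, by linarith⟩)
    | exact Or.inr (Or.inr ⟨by linarith, by linarith⟩)

/-- **Pair covering** (729 linear cases): if for each of the six coordinate pairs one of `a`, `b`, `a − b`
vanishes in both coordinates, then `a = 0`, `b = 0` or `a = b`. [folklore] -/
theorem sep_core (a0 a1 a2 a3 b0 b1 b2 b3 : ℝ)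
    (p01 : (a0 = 0 ∧ a1 = 0) ∨ (b0 = 0 ∧ b1 = 0) ∨ (a0 = b0 ∧ a1 = b1))
    (p02 : (a0 = 0 ∧ a2 = 0) ∨ (b0 = 0 ∧ b2 = 0) ∨ (a0 = b0 ∧ a2 = b2))
    (p03 : (a0 = 0 ∧ a3 = 0) ∨ (b0 = 0 ∧ b3 = 0) ∨ (a0 = b0 ∧ a3 = b3))
    (p12 : (a1 = 0 ∧ a2 = 0) ∨ (b1 = 0 ∧ b2 = 0) ∨ (a1 = b1 ∧ a2 = b2))
    (p13 : (a1 = 0 ∧ a3 = 0) ∨ (b1 = 0 ∧ b3 = 0) ∨ (a1 = b1 ∧ a3 = b3))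
    (p23 : (a2 = 0 ∧ a3 = 0) ∨ (b2 = 0 ∧ b3 = 0) ∨ (a2 = b2 ∧ a3 = b3)) :
    (a0 = 0 ∧ a1 = 0 ∧ a2 = 0 ∧ a3 = 0) ∨ (b0 = 0 ∧ b1 = 0 ∧ b2 = 0 ∧ b3 = 0) ∨
      (a0 = b0 ∧ a1 = b1 ∧ a2 = b2 ∧ a3 = b3) := by
  rcases p01 with ⟨h1, h2⟩ | ⟨h1, h2⟩ | ⟨h1, h2⟩ <;> rcases p02 with ⟨h3, h4⟩ | ⟨h3, h4⟩ | ⟨h3, h4⟩ <;>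
    rcases p03 with ⟨h5, h6⟩ | ⟨h5, h6⟩ | ⟨h5, h6⟩ <;> rcases p12 with ⟨h7, h8⟩ | ⟨h7, h8⟩ | ⟨h7, h8⟩ <;>
    rcases p13 with ⟨h9, h10⟩ | ⟨h9, h10⟩ | ⟨h9, h10⟩ <;>
    rcases p23 with ⟨h11, h12⟩ | ⟨h11, h12⟩ | ⟨h11, h12⟩ <;>
    subst_vars <;>
    first
    | exact Or.inl ⟨rfl, rfl, rfl, rfl⟩
    | exact Or.inr (Or.inl ⟨rfl, rfl, rfl, rfl⟩)
    | exact Or.inr (Or.inr ⟨rfl, rfl, rfl, rfl⟩)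

/-! ## §2 Three points are frame-separated -/

/-- Pairing with an axis normal is a coordinate. -/
theorem inner_single_one (a : E4) (μ : Fin 4) : ⟪a, EuclideanSpace.single μ (1 : ℝ)⟫_ℝ = a μ := by
  rw [EuclideanSpace.inner_single_right]; simp

/-- Pairing with a diagonal normal `e_μ + e_ν`. -/
theorem inner_single_add (a : E4) (μ ν : Fin 4) :
    ⟪a, EuclideanSpace.single μ (1 : ℝ) + EuclideanSpace.single ν 1⟫_ℝ = a μ + a ν := by
  rw [inner_add_right, inner_single_one, inner_single_one]

/-- Pairing with a diagonal normal `e_μ − e_ν`. -/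
theorem inner_single_sub (a : E4) (μ ν : Fin 4) :
    ⟪a, EuclideanSpace.single μ (1 : ℝ) - EuclideanSpace.single ν 1⟫_ℝ = a μ - a ν := by
  rw [inner_sub_right, inner_single_one, inner_single_one]

/-- Axis normals are mirror normals. -/
theorem isMirrorNormal_single (μ : Fin 4) : IsMirrorNormal (EuclideanSpace.single μ 1) := ⟨μ, Or.inl rfl⟩

/-- Diagonal normals `e_μ + e_ν` are mirror normals. -/
theorem isMirrorNormal_add {μ ν : Fin 4} (h : μ ≠ ν) :
    IsMirrorNormal (EuclideanSpace.single μ 1 + EuclideanSpace.single ν 1) := ⟨μ, Or.inr ⟨ν, h, Or.inl rfl⟩⟩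

/-- Diagonal normals `e_μ − e_ν` are mirror normals. -/
theorem isMirrorNormal_sub {μ ν : Fin 4} (h : μ ≠ ν) :
    IsMirrorNormal (EuclideanSpace.single μ 1 - EuclideanSpace.single ν 1) := ⟨μ, Or.inr ⟨ν, h, Or.inr rfl⟩⟩

/-- If the pairings of three points with `n` are not pairwise distinct, then, with `a = x₁ − x₀`, `b = x₂ − x₀`:
`⟪a,n⟫ = 0 ∨ ⟪b,n⟫ = 0 ∨ ⟪a,n⟫ = ⟪b,n⟫`. -/
theorem not_injective_pairings {x : Fin 3 → E4} {n : E4} (h : ¬ Function.Injective fun i => ⟪x i, n⟫_ℝ) :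
    ⟪x 1 - x 0, n⟫_ℝ = 0 ∨ ⟪x 2 - x 0, n⟫_ℝ = 0 ∨ ⟪x 1 - x 0, n⟫_ℝ = ⟪x 2 - x 0, n⟫_ℝ := by
  simp only [Function.Injective, not_forall] at h
  obtain ⟨i, j, hij, hne⟩ := h
  simp only [inner_sub_left]
  fin_cases i <;> fin_cases j
  · exact absurd rfl hne
  · exact Or.inl (by simp at hij; linarith)
  · exact Or.inr (Or.inl (by simp at hij; linarith))
  · exact Or.inl (by simp at hij; linarith)
  · exact absurd rfl hne
  · exact Or.inr (Or.inr (by simp at hij; linarith))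
  · exact Or.inr (Or.inl (by simp at hij; linarith))
  · exact Or.inr (Or.inr (by simp at hij; linarith))
  · exact absurd rfl hne

/-- The plane pigeonhole applied to the coordinate pair `(μ, ν)`. -/
theorem pair_of_not_separated {x : Fin 3 → E4}
    (H : ∀ n : E4, IsMirrorNormal n → ¬ Function.Injective fun i => ⟪x i, n⟫_ℝ) {μ ν : Fin 4} (hμν : μ ≠ ν) :
    ((x 1 - x 0) μ = 0 ∧ (x 1 - x 0) ν = 0) ∨ ((x 2 - x 0) μ = 0 ∧ (x 2 - x 0) ν = 0) ∨
      ((x 1 - x 0) μ = (x 2 - x 0) μ ∧ (x 1 - x 0) ν = (x 2 - x 0) ν) := by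
  have h1 := not_injective_pairings (H _ (isMirrorNormal_single μ))
  have h2 := not_injective_pairings (H _ (isMirrorNormal_single ν))
  have h3 := not_injective_pairings (H _ (isMirrorNormal_add hμν))
  have h4 := not_injective_pairings (H _ (isMirrorNormal_sub hμν))
  simp only [inner_single_one, inner_single_add, inner_single_sub] at h1 h2 h3 h4
  exact pair_core _ _ _ _ h1 h2 h3 h4

/-- **Theorem (three points are frame-separated by the sixteen mirrors).** For every non-coincident
configuration of three points of `ℝ⁴` some mirror normal `n ∈ {e_μ, e_μ ± e_ν}` gives pairwise distinct
pairings `⟪xᵢ, n⟫` — the configuration is strictly time-ordered, after relabelling, in the frame with time axis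
`n/‖n‖`. Hence the exceptional set `𝔈₃` of the junk mechanism is the coincidence locus. [folklore] -/
theorem three_points_frame_separated (x : Fin 3 → E4) (hx : x ∉ coincidenceLocus 3 E4) :
    ∃ n : E4, IsMirrorNormal n ∧ Function.Injective fun i => ⟪x i, n⟫_ℝ := by
  by_contra H
  simp only [not_exists, not_and] at H
  have key := sep_core ((x 1 - x 0) 0) ((x 1 - x 0) 1) ((x 1 - x 0) 2) ((x 1 - x 0) 3)
    ((x 2 - x 0) 0) ((x 2 - x 0) 1) ((x 2 - x 0) 2) ((x 2 - x 0) 3)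
    (pair_of_not_separated H (by decide : (0 : Fin 4) ≠ 1))
    (pair_of_not_separated H (by decide : (0 : Fin 4) ≠ 2))
    (pair_of_not_separated H (by decide : (0 : Fin 4) ≠ 3))
    (pair_of_not_separated H (by decide : (1 : Fin 4) ≠ 2))
    (pair_of_not_separated H (by decide : (1 : Fin 4) ≠ 3))
    (pair_of_not_separated H (by decide : (2 : Fin 4) ≠ 3))
  have vec : ∀ v : E4, v 0 = 0 → v 1 = 0 → v 2 = 0 → v 3 = 0 → v = 0 := by
    intro v h0 h1 h2 h3
    ext k
    fin_cases k <;> assumption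
  apply hx
  rcases key with ⟨h0, h1, h2, h3⟩ | ⟨h0, h1, h2, h3⟩ | ⟨h0, h1, h2, h3⟩
  · exact ⟨1, 0, by decide, sub_eq_zero.1 (vec _ h0 h1 h2 h3)⟩
  · exact ⟨2, 0, by decide, sub_eq_zero.1 (vec _ h0 h1 h2 h3)⟩
  · refine ⟨1, 2, by decide, ?_⟩
    have h : x 1 - x 0 - (x 2 - x 0) = 0 :=
      vec _ (by simp only [PiLp.sub_apply] at h0 ⊢; linarith) (by simp only [PiLp.sub_apply] at h1 ⊢; linarith)
        (by simp only [PiLp.sub_apply] at h2 ⊢; linarith) (by simp only [PiLp.sub_apply] at h3 ⊢; linarith)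
    have : x 1 - x 2 = 0 := by rw [← h]; abel
    exact sub_eq_zero.1 this

/-! ## §3 Four points are not -/

/-- Every mirror normal vanishes in coordinate `3`, `2` or `0` (its zero set has at least two elements). -/
theorem mirrorNormal_coord_zero {n : E4} (hn : IsMirrorNormal n) : n 3 = 0 ∨ n 2 = 0 ∨ n 0 = 0 := by
  obtain ⟨μ, rfl | ⟨ν, hμν, rfl | rfl⟩⟩ := hn
  · fin_cases μ <;> simp
  · fin_cases μ <;> fin_cases ν <;> simp_all
  · fin_cases μ <;> fin_cases ν <;> simp_all

/-- The bump centres `0, 10e₃, 10e₂, 10e₀` of file IV are pairwise distinct. -/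
theorem ctr_not_mem_coincidenceLocus : ctr ∉ coincidenceLocus 4 E4 := by
  rintro ⟨i, j, hij, h⟩
  obtain ⟨k, hk⟩ := ctr_sub_coord i j hij
  rw [h, sub_self] at hk
  simp at hk

/-- **Theorem (four points need not be frame-separated).** The non-coincident configuration
`0, 10e₃, 10e₂, 10e₀` has, in EVERY one of the sixteen frames, two points with equal time: the exceptional set
`𝔈₄` is strictly larger than the coincidence locus (and carries the junk functional `J` of file II). [folklore] -/
theorem four_points_not_frame_separated :
    ∃ x : Fin 4 → E4, x ∉ coincidenceLocus 4 E4 ∧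
      ∀ n : E4, IsMirrorNormal n → ¬ Function.Injective fun i => ⟪x i, n⟫_ℝ := by
  refine ⟨ctr, ctr_not_mem_coincidenceLocus, fun n hn hinj => ?_⟩
  obtain ⟨p, q, hpq, h⟩ := exists_pair_inner_eq ystar n (mirrorNormal_coord_zero hn)
  rw [A_ystar] at h
  exact hpq (hinj h)

end Summit.QuantumFields.YangMills.Theorems.NPointIsotropy.Negative

end
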